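import Summits.QuantumFields.BalabanUV.Beta.GAN24.ExchangeReadout

/-!
# `BalabanUV.Beta.GAN24.SandwichReadoutSiteCharges` — binder row G-an2-4 ∕ (CONV-C), W-slot CT-W, conservation law (C)∕(C)sym, step (P5)(I) of this lineage's
# note `HOME/b2b-balaban-gan24-formalise-leaf-04/g65/CSYM-LEVEL0-KERNEL-BLUEPRINT.md`: **THE SANDWICH ∕ EXCHANGE ∕ `K3OfK` READ-OUTS WITH SITE-DEPENDENT
# COARSE-LEG CHARGES** — leaf-06's `ResolventLegCharges.hasSum_sandwich_readout`, `ExchangeReadout.hasSum_exchange_readout`, `ExchangeReadout.hasSum_mmRead_K3OfK`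
# VERBATIM with the charges `ρL f`, `ρR g` allowed to depend on the fine site of the leg (`ρL f y`, `ρR g w`) — the currency of a DRESSED kernel, whose coarse-leg
# charges are exit-face profiles (sequel `GAN24.DressedStepFaceCharges`)

NOT IN PRINT; OUR BOOKKEEPING ([folklore] Fubini over absolutely convergent lattice sums; the proofs are leaf-06 gen 8's, re-run with two-argument charges — the
site-freeness was used only in the evaluation of the inner coarse sums; G-an2-4 formalisation swarm, leaf prover `b2b-balaban-gan24-formalise-leaf-04`, gen 65).
HONEST FRAMING (cell contract, verbatim): «discharging `BetaPertH` makes Bałaban's UV stability UNCONDITIONAL — a real constructive-QFT result; it is NOT the continuum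
limit and NOT the Clay problem.»  HONEST DEPENDENCY (verbatim): «continuum YM on T⁴ ⇐ BetaPertH ∧ nine spine estimates (0/9 proved); BetaPertH ⇐ (D1) ∧ (D4) ∧
CAP+tail; G-an2-4 gates asym, D1 and NE2/3/4.»

WHY (blueprint §1 (I)): the conservation law (C_1) at level 0 compares the ff zero modes of the dressed and undressed one-step SOURCES `b̃_0 ∕ b_0 = (cE₂·Lc^{2(d+1)}) •
mmRead Lc (K3OfK X♮ Lc S♮_0 M♮_0 W♮⁰_0) + border` (p2's `T2RecChargeStepFourFace.zmode_succ_eq_fourFace` ∕ `T2RecChargeStepMap.zmode_stepB_eq`); for the undressed kernel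
`X♮ = unitK s_f s_m (KInvStep Lc j)` the read-out is leaf-06's `ExchangeReadout.hasSum_mmRead_K3OfK_unitKStep` (site-free charges `∓δ·σ_j`); for the DRESSED kernel
`unitK s_f s_m (coDressKBmAt ρ Lc (KInvStep Lc j))` the charges are `Lc·𝟙[exit face]·(∓δ·σ_j)` — site-dependent — and THIS FILE is the read-out in that currency.

WHAT ([folklore]; generic `d`, blocking `N ≥ 1`, decaying `K`, localised `P Q V W dM`; 0 `def`, 0 cited facts, 0 `def … : Prop`, 0 sorry): §1 **`hasSum_sandwich_readout_site`**
(`Σ'_{(x′,z′)} (K∘V∘K)(N•x′, N•z′)_{(inr α, inr β)}` has the `HasSum` `Σ'_{(y,w)} Σ_{f,g} ρL f y·V y w f g·ρR g w`); §2 **`hasSum_exchange_readout_site`** (the exchange tree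
`K∘P∘K∘Q∘K`), **`hasSum_mmRead_K3OfK_site`** (the ff block of `mmRead N (K3OfK K N S M W b b′)` = `R[(dM_b∘K)∘dM_{b′}] + R[(dM_{b′}∘K)∘dM_b] − R[W_{bb′}]`,
`R[V] := Σ'_{(y,w)} Σ_{f,g} ρL f y·V y w f g·ρR g w`).  Asserts NO value of Bałaban's tables; discharges NOTHING of (C)sym ∕ (Q-D) ∕ (Q-D-rate) ∕ «T2Shape» ∕ «T2Drift» ∕
(hW, hWall); NEVER «G-an2-4 closed» as (CONV-C); NOT D1, NOT `BetaPertH`, NOT continuum, NOT Clay.  2026-08-22; no existing file touched.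
-/

noncomputable section

open Finset
open scoped BigOperators
open Literature.MathematicalPhysics.QuantumFieldTheory
open Literature.MathematicalPhysics.QuantumFieldTheory.Balaban1983to89
open Literature.MathematicalPhysics.QuantumFieldTheory.Balaban1983to89.Beta
open B12Sec2to5 (l1 l1_nonneg)
open ExpKernelCalculus (Site MKer BiLoc Decays VertexFamily comp Zl Zl_nonneg summable_exp_shift summable_exp_shift')
open OneStepResolventKernel (Fib LocStencil)
open SecondOrderResponse (dM K2OfK)
open BalabanStepW2 (K3OfK)
open BalabanStepJetsSucc (mmRead mmRead_inl_inl)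
open Summit.QuantumFields.BalabanUV.Beta.TameKernelCalculus (Spr Loc Tame)
open Summit.QuantumFields.BalabanUV.Beta.GAN24.KernelLegCharges (summable_exp_coarse)
open Summit.QuantumFields.BalabanUV.Beta.GAN24.ResolventLegCharges (tsum_exp_coarse_le tsum_exp_coarse_le' summable_exp_coarse' summable_legs_prod)
open Summit.QuantumFields.BalabanUV.Beta.GAN24.ExchangeReadout (exchange_eq_sandwich K3OfK_apply_eq)

namespace Summit.QuantumFields.BalabanUV.Beta.GAN24.SandwichReadoutSiteCharges

variable {d : ℕ} {N : ℕ} [NeZero N]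

/-! ## §1 The sandwich read-out Fubini with site-dependent coarse-leg charges -/

/-- [folklore] **THE SANDWICH READ-OUT FUBINI, SITE-DEPENDENT CHARGES** (leaf-06's `ResolventLegCharges.hasSum_sandwich_readout` VERBATIM with the coarse-leg charges
allowed to depend on the fine site of the leg: `ρL f y`, `ρR g w` — the case of a DRESSED kernel, whose charges are exit-face profiles): for a decaying `K` and a
bi-localised `V`, the `mm`-entries of `K ∘ V ∘ K` at the coarse points have the double-leg `HasSum` `Σ'_{(y,w)} Σ_{f,g} ρL f y · V y w f g · ρR g w`. -/
theorem hasSum_sandwich_readout_site {K V : MKer (d + 1) (Fib d)} {C δ Cv δv : ℝ} {p q : Site (d + 1)} (hK : Decays K C δ) (hδ : 0 < δ)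
    (hV : BiLoc V p q Cv δv) (hδv : 0 < δv) (α β : Fin (d + 1)) {ρL ρR : Fib d → Site (d + 1) → ℝ}
    (hrow : ∀ f y, HasSum (fun x' : Site (d + 1) => K ((N : ℤ) • x') y (Sum.inr α) f) (ρL f y))
    (hcol : ∀ g w, HasSum (fun z' : Site (d + 1) => K w ((N : ℤ) • z') g (Sum.inr β)) (ρR g w)) :
    HasSum (fun xz : Site (d + 1) × Site (d + 1) => comp (comp K V) K ((N : ℤ) • xz.1) ((N : ℤ) • xz.2) (Sum.inr α) (Sum.inr β))
      (∑' yw : Site (d + 1) × Site (d + 1), ∑ f, ∑ g, ρL f yw.1 * V yw.1 yw.2 f g * ρR g yw.2) := by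
  classical
  have hN : 1 ≤ N := Nat.one_le_iff_ne_zero.2 (NeZero.ne N)
  have hC : 0 ≤ C := hK.nonneg (Sum.inl 0)
  have hCv : 0 ≤ Cv := hV.nonneg (Sum.inl 0)
  set cF : ℝ := ((Fintype.card (Fib d) : ℕ) : ℝ) with hcF
  -- the four-leg family, outer index `(y, w)`, inner index `(x′, z′)`
  set Φ : Site (d + 1) × Site (d + 1) → Site (d + 1) × Site (d + 1) → ℝ := fun yw xz =>
    ∑ f, ∑ g, K ((N : ℤ) • xz.1) yw.1 (Sum.inr α) f * V yw.1 yw.2 f g * K yw.2 ((N : ℤ) • xz.2) g (Sum.inr β) with hΦ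
  -- the majorant and its sums
  set U : ℝ := Real.exp (δ * ((N : ℝ) * (d + 1))) * Zl (d + 1) δ with hU
  set M : Site (d + 1) × Site (d + 1) → Site (d + 1) × Site (d + 1) → ℝ := fun yw xz =>
    (cF * cF * (C * Cv * C) * Real.exp (-δv * (l1 (yw.1 - p) + l1 (yw.2 - q)))) *
      (Real.exp (-δ * l1 ((N : ℤ) • xz.1 - yw.1)) * Real.exp (-δ * l1 (yw.2 - (N : ℤ) • xz.2))) with hM
  have hM0 : ∀ yw xz, 0 ≤ M yw xz := fun yw xz => by positivity
  have hΦM : ∀ yw xz, |Φ yw xz| ≤ M yw xz := by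
    intro yw xz
    have hterm : ∀ f g, |K ((N : ℤ) • xz.1) yw.1 (Sum.inr α) f * V yw.1 yw.2 f g * K yw.2 ((N : ℤ) • xz.2) g (Sum.inr β)| ≤
        (C * Real.exp (-δ * l1 ((N : ℤ) • xz.1 - yw.1))) * (Cv * Real.exp (-δv * (l1 (yw.1 - p) + l1 (yw.2 - q)))) *
          (C * Real.exp (-δ * l1 (yw.2 - (N : ℤ) • xz.2))) := by
      intro f g
      rw [abs_mul, abs_mul]
      have e1 := hK ((N : ℤ) • xz.1) yw.1 (Sum.inr α) f
      have e2 := hV yw.1 yw.2 f g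
      have e3 := hK yw.2 ((N : ℤ) • xz.2) g (Sum.inr β)
      exact mul_le_mul (mul_le_mul e1 e2 (abs_nonneg _) ((abs_nonneg _).trans e1)) e3 (abs_nonneg _)
        (mul_nonneg ((abs_nonneg _).trans e1) ((abs_nonneg _).trans e2))
    calc |Φ yw xz| ≤ ∑ f, ∑ g, |K ((N : ℤ) • xz.1) yw.1 (Sum.inr α) f * V yw.1 yw.2 f g * K yw.2 ((N : ℤ) • xz.2) g (Sum.inr β)| :=
          (Finset.abs_sum_le_sum_abs _ _).trans (Finset.sum_le_sum fun f _ => Finset.abs_sum_le_sum_abs _ _)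
      _ ≤ ∑ _f : Fib d, ∑ _g : Fib d, (C * Real.exp (-δ * l1 ((N : ℤ) • xz.1 - yw.1))) *
            (Cv * Real.exp (-δv * (l1 (yw.1 - p) + l1 (yw.2 - q)))) * (C * Real.exp (-δ * l1 (yw.2 - (N : ℤ) • xz.2))) :=
          Finset.sum_le_sum fun f _ => Finset.sum_le_sum fun g _ => hterm f g
      _ = M yw xz := by
          simp only [Finset.sum_const, Finset.card_univ, nsmul_eq_mul, hM, hcF]
          ring
  -- inner sums of the majorant
  have hMin : ∀ yw, HasSum (fun xz => M yw xz)
      ((cF * cF * (C * Cv * C) * Real.exp (-δv * (l1 (yw.1 - p) + l1 (yw.2 - q)))) *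
        ((∑' x' : Site (d + 1), Real.exp (-δ * l1 ((N : ℤ) • x' - yw.1))) *
          ∑' z' : Site (d + 1), Real.exp (-δ * l1 (yw.2 - (N : ℤ) • z')))) := by
    intro yw
    have h1 := summable_exp_coarse (d := d) hN hδ yw.1
    have h2 := summable_exp_coarse' (d := d) hN hδ yw.2
    have h12 := h1.hasSum.mul h2.hasSum (h1.mul_of_nonneg h2 (fun _ => (Real.exp_pos _).le) (fun _ => (Real.exp_pos _).le))
    exact h12.mul_left _
  have hMs : Summable (Function.uncurry M) := by
    refine (summable_prod_of_nonneg (fun s => hM0 s.1 s.2)).2 ⟨fun yw => (hMin yw).summable, ?_⟩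
    have hbound : ∀ yw : Site (d + 1) × Site (d + 1), ∑' xz, M yw xz ≤
        (cF * cF * (C * Cv * C) * (U * U)) * (Real.exp (-δv * l1 (yw.1 - p)) * Real.exp (-δv * l1 (yw.2 - q))) := by
      intro yw
      rw [(hMin yw).tsum_eq, mul_add, Real.exp_add]
      have hA := tsum_exp_coarse_le (d := d) N hδ yw.1
      have hB := tsum_exp_coarse_le' (d := d) N hδ yw.2
      have hA0 : 0 ≤ ∑' x' : Site (d + 1), Real.exp (-δ * l1 ((N : ℤ) • x' - yw.1)) := tsum_nonneg fun _ => (Real.exp_pos _).le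
      have hB0 : 0 ≤ ∑' z' : Site (d + 1), Real.exp (-δ * l1 (yw.2 - (N : ℤ) • z')) := tsum_nonneg fun _ => (Real.exp_pos _).le
      have hU0 : 0 ≤ U := mul_nonneg (Real.exp_pos _).le (Zl_nonneg hδ)
      have hAB := mul_le_mul hA hB hB0 hU0
      have hc0 : 0 ≤ cF * cF * (C * Cv * C) * (Real.exp (-δv * l1 (yw.1 - p)) * Real.exp (-δv * l1 (yw.2 - q))) := by positivity
      calc cF * cF * (C * Cv * C) * (Real.exp (-δv * l1 (yw.1 - p)) * Real.exp (-δv * l1 (yw.2 - q))) *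
            ((∑' x' : Site (d + 1), Real.exp (-δ * l1 ((N : ℤ) • x' - yw.1))) * ∑' z' : Site (d + 1), Real.exp (-δ * l1 (yw.2 - (N : ℤ) • z')))
          ≤ cF * cF * (C * Cv * C) * (Real.exp (-δv * l1 (yw.1 - p)) * Real.exp (-δv * l1 (yw.2 - q))) * (U * U) :=
            mul_le_mul_of_nonneg_left hAB hc0
        _ = _ := by ring
    have hsum : Summable fun yw : Site (d + 1) × Site (d + 1) =>
        (cF * cF * (C * Cv * C) * (U * U)) * (Real.exp (-δv * l1 (yw.1 - p)) * Real.exp (-δv * l1 (yw.2 - q))) :=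
      ((summable_exp_shift' hδv p).mul_of_nonneg (summable_exp_shift' hδv q) (fun _ => (Real.exp_pos _).le)
        (fun _ => (Real.exp_pos _).le)).mul_left _
    exact Summable.of_nonneg_of_le (fun yw => tsum_nonneg fun xz => hM0 yw xz) hbound hsum
  -- (A) absolute summability of the four-leg family
  have hΦs : Summable (Function.uncurry Φ) :=
    Summable.of_norm_bounded hMs (fun s => by rw [Real.norm_eq_abs]; exact hΦM s.1 s.2)
  -- (C) the inner sums: only the charges survive
  have hΦin : ∀ yw : Site (d + 1) × Site (d + 1), HasSum (fun xz => Φ yw xz) (∑ f, ∑ g, ρL f yw.1 * V yw.1 yw.2 f g * ρR g yw.2) := by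
    intro yw
    refine hasSum_sum fun f _ => hasSum_sum fun g _ => ?_
    have hmul := ((hrow f yw.1).mul (hcol g yw.2) (summable_legs_prod hK hδ yw.1 yw.2 _ _ f g)).mul_left (V yw.1 yw.2 f g)
    rw [show V yw.1 yw.2 f g * (ρL f yw.1 * ρR g yw.2) = ρL f yw.1 * V yw.1 yw.2 f g * ρR g yw.2 by ring] at hmul
    exact hmul.congr_fun fun xz => by ring
  -- (B) the pointwise identity: the nested composition IS the `(y, w)`-sum of `Φ`
  have hΦyw : ∀ xz : Site (d + 1) × Site (d + 1), Summable fun yw : Site (d + 1) × Site (d + 1) => Φ yw xz :=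
    fun xz => hΦs.prod_symm.prod_factor xz
  have hpoint : ∀ xz : Site (d + 1) × Site (d + 1),
      comp (comp K V) K ((N : ℤ) • xz.1) ((N : ℤ) • xz.2) (Sum.inr α) (Sum.inr β) = ∑' yw : Site (d + 1) × Site (d + 1), Φ yw xz := by
    intro xz
    -- summability of the `(w, y)`-ordered family and of its `y`-slices with one fibre index fixed
    have hwy : Summable fun wy : Site (d + 1) × Site (d + 1) => Φ (wy.2, wy.1) xz :=
      (Equiv.prodComm (Site (d + 1)) (Site (d + 1))).summable_iff.2 (hΦyw xz) |>.congr fun wy => rfl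
    have hslice : ∀ (w : Site (d + 1)) (g : Fib d), Summable fun y : Site (d + 1) =>
        ∑ f, K ((N : ℤ) • xz.1) y (Sum.inr α) f * V y w f g * K w ((N : ℤ) • xz.2) g (Sum.inr β) := by
      intro w g
      have hmaj : Summable fun y : Site (d + 1) => (cF * (C * Cv * (C * Real.exp (-δ * l1 (w - (N : ℤ) • xz.2))))) *
          Real.exp (-δ * l1 ((N : ℤ) • xz.1 - y)) := (summable_exp_shift hδ _).mul_left _
      refine Summable.of_norm_bounded hmaj (fun y => ?_)
      rw [Real.norm_eq_abs]
      have hterm : ∀ f, |K ((N : ℤ) • xz.1) y (Sum.inr α) f * V y w f g * K w ((N : ℤ) • xz.2) g (Sum.inr β)| ≤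
          (C * Real.exp (-δ * l1 ((N : ℤ) • xz.1 - y))) * Cv * (C * Real.exp (-δ * l1 (w - (N : ℤ) • xz.2))) := by
        intro f
        rw [abs_mul, abs_mul]
        have e1 := hK ((N : ℤ) • xz.1) y (Sum.inr α) f
        have e2 : |V y w f g| ≤ Cv := by
          refine (hV y w f g).trans ?_
          have : Real.exp (-δv * (l1 (y - p) + l1 (w - q))) ≤ 1 :=
            Real.exp_le_one_iff.2 (by nlinarith [l1_nonneg (y - p), l1_nonneg (w - q)])
          nlinarith
        have e3 := hK w ((N : ℤ) • xz.2) g (Sum.inr β)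
        exact mul_le_mul (mul_le_mul e1 e2 (abs_nonneg _) ((abs_nonneg _).trans e1)) e3 (abs_nonneg _)
          (mul_nonneg ((abs_nonneg _).trans e1) ((abs_nonneg _).trans e2))
      calc |∑ f, K ((N : ℤ) • xz.1) y (Sum.inr α) f * V y w f g * K w ((N : ℤ) • xz.2) g (Sum.inr β)|
          ≤ ∑ f, |K ((N : ℤ) • xz.1) y (Sum.inr α) f * V y w f g * K w ((N : ℤ) • xz.2) g (Sum.inr β)| := Finset.abs_sum_le_sum_abs _ _
        _ ≤ ∑ _f : Fib d, (C * Real.exp (-δ * l1 ((N : ℤ) • xz.1 - y))) * Cv * (C * Real.exp (-δ * l1 (w - (N : ℤ) • xz.2))) :=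
            Finset.sum_le_sum fun f _ => hterm f
        _ = _ := by simp only [Finset.sum_const, Finset.card_univ, nsmul_eq_mul, hcF]; ring
    -- rewrite the nested composition
    have hinner : ∀ w : Site (d + 1), ∑ g, comp K V ((N : ℤ) • xz.1) w (Sum.inr α) g * K w ((N : ℤ) • xz.2) g (Sum.inr β)
        = ∑' y : Site (d + 1), Φ (y, w) xz := by
      intro w
      have e1 : ∀ g, comp K V ((N : ℤ) • xz.1) w (Sum.inr α) g * K w ((N : ℤ) • xz.2) g (Sum.inr β)
          = ∑' y : Site (d + 1), ∑ f, K ((N : ℤ) • xz.1) y (Sum.inr α) f * V y w f g * K w ((N : ℤ) • xz.2) g (Sum.inr β) := by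
        intro g
        simp only [comp]
        rw [← tsum_mul_right]
        exact tsum_congr fun y => by rw [Finset.sum_mul]
      simp_rw [e1]
      rw [(Summable.tsum_finsetSum fun g _ => hslice w g).symm]
      exact tsum_congr fun y => Finset.sum_comm
    calc comp (comp K V) K ((N : ℤ) • xz.1) ((N : ℤ) • xz.2) (Sum.inr α) (Sum.inr β)
        = ∑' w : Site (d + 1), ∑' y : Site (d + 1), Φ (y, w) xz := by
          simp only [comp] at hinner ⊢
          exact tsum_congr fun w => hinner w
      _ = ∑' wy : Site (d + 1) × Site (d + 1), Φ (wy.2, wy.1) xz := (hwy.tsum_prod).symm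
      _ = ∑' yw : Site (d + 1) × Site (d + 1), Φ yw xz :=
          (Equiv.prodComm (Site (d + 1)) (Site (d + 1))).tsum_eq (fun yw : Site (d + 1) × Site (d + 1) => Φ yw xz)
  -- (D) assemble
  have hF : Summable fun xz : Site (d + 1) × Site (d + 1) => ∑' yw : Site (d + 1) × Site (d + 1), Φ yw xz := hΦs.prod_symm.prod
  have hval : ∑' xz : Site (d + 1) × Site (d + 1), ∑' yw : Site (d + 1) × Site (d + 1), Φ yw xz
      = ∑' yw : Site (d + 1) × Site (d + 1), ∑ f, ∑ g, ρL f yw.1 * V yw.1 yw.2 f g * ρR g yw.2 := by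
    rw [hΦs.tsum_comm]
    exact tsum_congr fun yw => (hΦin yw).tsum_eq
  have h := hF.hasSum
  rw [hval] at h
  exact h.congr_fun fun xz => hpoint xz

/-! ## §2 The exchange tree and an2's `K3OfK` read at site-dependent charges -/

/-- [folklore] **THE EXCHANGE READ-OUT, SITE-DEPENDENT CHARGES** (leaf-06's `ExchangeReadout.hasSum_exchange_readout` with `ρL f y`, `ρR g w`): the `mm`-entries of
the exchange tree `K∘P∘K∘Q∘K` at the coarse points have the double-leg `HasSum` `Σ'_{(y,w)} Σ_{f,g} ρL f y · ((P∘K)∘Q) y w f g · ρR g w`. -/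
theorem hasSum_exchange_readout_site {K P Q : MKer (d + 1) (Fib d)} {C δ : ℝ} (hK : Decays K C δ) (hδ : 0 < δ) (hP : Loc P) (hQ : Loc Q)
    (α β : Fin (d + 1)) {ρL ρR : Fib d → Site (d + 1) → ℝ}
    (hrow : ∀ f y, HasSum (fun x' : Site (d + 1) => K ((N : ℤ) • x') y (Sum.inr α) f) (ρL f y))
    (hcol : ∀ g w, HasSum (fun z' : Site (d + 1) => K w ((N : ℤ) • z') g (Sum.inr β)) (ρR g w)) :
    HasSum (fun xz : Site (d + 1) × Site (d + 1) =>
        comp (comp K P) (comp (comp K Q) K) ((N : ℤ) • xz.1) ((N : ℤ) • xz.2) (Sum.inr α) (Sum.inr β))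
      (∑' yw : Site (d + 1) × Site (d + 1), ∑ f, ∑ g, ρL f yw.1 * comp (comp P K) Q yw.1 yw.2 f g * ρR g yw.2) := by
  have hKs : Spr K := ⟨C, δ, hδ, hK⟩
  obtain ⟨p, q, Cv, δv, hδv, hV⟩ := (hP.comp_spr hKs).comp hQ
  rw [exchange_eq_sandwich hKs hP hQ]
  exact hasSum_sandwich_readout_site hK hδ hV hδv α β hrow hcol

/-- [folklore] **THE READ-OUT OF `K3OfK`, SITE-DEPENDENT CHARGES** (leaf-06's `ExchangeReadout.hasSum_mmRead_K3OfK` with `ρL f y`, `ρR g w`): with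
`R[V] := Σ'_{(y,w)} Σ_{f,g} ρL f y · V y w f g · ρR g w`, the field–field block of `mmRead N (K3OfK K N S M W μ y ν y′)` has the double-leg `HasSum`
`R[(dM_b∘K)∘dM_{b′}] + R[(dM_{b′}∘K)∘dM_b] − R[W_{bb′}]` — the two EXCHANGE words and the `K·W·K` word of the dressed one-step source, channel by channel. -/
theorem hasSum_mmRead_K3OfK_site {K : MKer (d + 1) (Fib d)} {C δ : ℝ} (hK : Decays K C δ) (hδ : 0 < δ)
    {S M : Fin (d + 1) → Site (d + 1) → MKer (d + 1) (Fib d)}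
    {W : Fin (d + 1) → Site (d + 1) → Fin (d + 1) → Site (d + 1) → MKer (d + 1) (Fib d)} {μ ν : Fin (d + 1)} {y y' : Site (d + 1)}
    (hb : Loc (dM K N S M μ y)) (hb' : Loc (dM K N S M ν y')) (hW : Loc (W μ y ν y')) (α β : Fin (d + 1)) {ρL ρR : Fib d → Site (d + 1) → ℝ}
    (hrow : ∀ f w, HasSum (fun x' : Site (d + 1) => K ((N : ℤ) • x') w (Sum.inr α) f) (ρL f w))
    (hcol : ∀ g w, HasSum (fun z' : Site (d + 1) => K w ((N : ℤ) • z') g (Sum.inr β)) (ρR g w)) :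
    HasSum (fun xz : Site (d + 1) × Site (d + 1) => mmRead N (K3OfK K N S M W μ y ν y') xz.1 xz.2 (Sum.inl α) (Sum.inl β))
      ((∑' yw : Site (d + 1) × Site (d + 1), ∑ f, ∑ g,
          ρL f yw.1 * comp (comp (dM K N S M μ y) K) (dM K N S M ν y') yw.1 yw.2 f g * ρR g yw.2) +
        (∑' yw : Site (d + 1) × Site (d + 1), ∑ f, ∑ g,
          ρL f yw.1 * comp (comp (dM K N S M ν y') K) (dM K N S M μ y) yw.1 yw.2 f g * ρR g yw.2) -
        ∑' yw : Site (d + 1) × Site (d + 1), ∑ f, ∑ g, ρL f yw.1 * W μ y ν y' yw.1 yw.2 f g * ρR g yw.2) := by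
  obtain ⟨p, q, Cw, δw, hδw, hWb⟩ := hW
  have h1 := hasSum_exchange_readout_site (N := N) hK hδ hb hb' α β hrow hcol
  have h2 := hasSum_exchange_readout_site (N := N) hK hδ hb' hb α β hrow hcol
  have h3 := hasSum_sandwich_readout_site (N := N) hK hδ hWb hδw α β hrow hcol
  refine ((h1.add h2).sub h3).congr_fun fun xz => ?_
  rw [mmRead_inl_inl, K3OfK_apply_eq]

end Summit.QuantumFields.BalabanUV.Beta.GAN24.SandwichReadoutSiteCharges

end
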